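import Literature.Computability.Cryptography.LatticeOWF
import Literature.Computability.Cryptography.SISFunction
import Literature.Computability.Cryptography.SISFunctionSolver
import Literature.Computability.Cryptography.SISFunctionProofs
import Literature.Computability.Cryptography.SISFunctionMachine
import Literature.Computability.Cryptography.GapSVPToSIS
import Literature.Algebra.EuclideanLattices.GapCVPPrimeMachine
import Literature.Computability.Complexity.PromiseCookReductionsProofs
import Literature.Computability.Cryptography.SISSolverMachine
import HarnessLib

/-!
# Assembly of the decomposition of `Literature.Computability.Cryptography.owfExist_of_gapSVP_worstCaseHard` (proofs only)

Sibling proof file (D-0014 provefact) of `Literature/Computability/Cryptography/LatticeOWF.lean`.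
The named fact `Literature.Computability.Cryptography.owfExist_of_gapSVP_worstCaseHard` (worst-case hardness of `GapSVP_γ`
for all polynomial factors, infinitely-often / promise-BPP′ form, gives one-way functions;
Micciancio–Regev 2007 Thm. 5.23 with §5.1, Ajtai 1996 Thm. 1) is reduced in `LatticeOWF.lean`
(`owfExist_of_gapSVP_worstCaseHard_of_MR07`, proved) to Micciancio–Regev's Theorem 5.23
(`MicciancioRegev2007_gapSVP_to_SIS'`, `SIS.lean`) and the existential SIS-function step
`Ajtai1996_sisFunction_inverter_to_SIS'`. `SISFunction.lean` builds ONE concrete candidate,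
Ajtai's function `SIS.sisFunction` with the parameters `SIS.modulus = 2^{16 ⌊log₂(2n+4)⌋}`,
`SIS.width = 2 n log₂ q`, `SIS.normBound = width + 1`, `SIS.dimOf`, and proves everything
elementary about them. This file (theorems only) closes the loop:

* `Ajtai1996_sisFunction_inverter_to_SIS'_of_core`: the two TM2-level facts
  (`sisFunction_polyTimeComputable`, `sisParams_isPolyTimeParams`) and the probabilistic core
  `Ajtai1996_sisFunction_core` about the concrete function give the existential step, with
  witnesses `q = SIS.modulus`, `m = SIS.width`, `β = SIS.normBound`, `g = SIS.sisFunction`,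
  `nOf = SIS.dimOf` (parameter conditions: the proved lemmas of `SISFunction.lean`);
* `owfExist_of_gapSVP_worstCaseHard_of_core`: hence the target fact from Theorem 5.23 and the
  three facts about the concrete function.

* `owfExist_of_gapSVP_worstCaseHard_of_solver`: with `SISFunctionSolver.lean`, which PROVES the
  probabilistic core up to the running time of the explicit reduction `SIS.sisSolver`
  (`Ajtai1996_sisFunction_core_of_solver`), the target fact follows from Theorem 5.23 and three
  TM2-level polynomial-time facts about explicit functions.

* `owfExist_of_gapSVP_worstCaseHard_of_leaves`: with `GapSVPToSIS.lean`, which splits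
  `MicciancioRegev2007_gapSVP_to_SIS'` into Theorem 5.23 proper (`GapCVP′ → SIS′`), the generic
  closure of promise-BPP under Cook reductions (Goldreich 2006) and the running time of the
  explicit GMSS oracle algorithm (Lemma 5.22 being PROVED as a Cook reduction in
  `GapCVPPrime.lean`), and with `SISFunctionProofs.lean`, which PROVES
  `sisParams_isPolyTimeParams`, the target fact follows from FIVE leaves (and, with `SISFunctionMachine.lean`, which PROVES
  `sisFunction_polyTimeComputable`, from FOUR: `owfExist_of_gapSVP_worstCaseHard_of_four`):
  `MicciancioRegev2007_gapCVP'_to_SIS'` (deep: MR07 §3–5),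
  `PromiseProblem.mem_PromiseBPP'_of_cookReducible` (generic, machine level), and the TM2
  running-time facts `gmssAlg_isPolyTime`, `sisFunction_polyTimeComputable`, `sisSolver_polyTime`.

Without that split, what remains for `owfExist_of_gapSVP_worstCaseHard_holds` are the four leaves
`MicciancioRegev2007_gapSVP_to_SIS'` (MR07 §3–5 with a TM2-level PPT reduction) and the
polynomial-time claims `sisFunction_polyTimeComputable`, `sisParams_isPolyTimeParams`,
`sisSolver_polyTime` (TM2 level: machine composition is available in the tree,
`PolyTimeComputable.comp_holds`; what is missing are TM2 routines / stack programs for the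
concrete string functions). All cryptographic and probabilistic content is proved.

* `owfExist_of_gapSVP_worstCaseHard_of_three`: with `GapCVPPrimeMachine.lean`, which PROVES
  `gmssAlg_isPolyTime`, three leaves remain: Theorem 5.23 proper, the promise-BPP Cook closure,
  and the running time of the SIS′ solver.

* `owfExist_of_gapSVP_worstCaseHard_of_two`: with `PromiseCookReductionsProofs.lean`, which
  PROVES the closure of promise-BPP under Cook reductions of promise problems (Goldreich 2006,
  §1.2, remark after Def. 3: `PromiseProblem.mem_PromiseBPP'_of_cookReducible_holds`), TWO leaves
  remain: Micciancio–Regev's Theorem 5.23 proper (`MicciancioRegev2007_gapCVP'_to_SIS'`, the deep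
  part: MR07 §3–5) and the TM2 running time of the explicit SIS′ solver (`sisSolver_polyTime`).

* `owfExist_of_gapSVP_worstCaseHard_of_one`: with `SISSolverMachine.lean` (and its bricks
  `SISSolverParams.lean`, `SISSolverKey.lean`), which PROVES `sisSolver_polyTime` (the run map of
  the explicit SIS′ solver is an `FP` string function assembled from the tree's brick algebra),
  ONE leaf remains: Micciancio–Regev's Theorem 5.23 proper, `MicciancioRegev2007_gapCVP'_to_SIS'`
  — the target fact now rests exactly on the printed deep theorem (GapCVP′ → SIS′).

## References

* M. Ajtai, *Generating hard instances of lattice problems*, STOC 1996, Thm. 1.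
* D. Micciancio, O. Regev, *Worst-case to average-case reductions based on Gaussian
  measures*, SIAM J. Comput. 37 (2007) 267–302; full version §5.1 (p. 18), Thm. 5.23 (p. 28).
* O. Goldreich, *Foundations of Cryptography I*, CUP 2001, Def. 2.2.1, §2.4.2.
-/

noncomputable section

namespace Literature.Computability.Cryptography

open Filter Complexity Literature.Algebra.EuclideanLattices SIS

/-- **Assembly of F2 from the concrete construction** (proved): the two TM2-level facts and the
probabilistic core about `SIS.sisFunction` give the existential named fact
`Ajtai1996_sisFunction_inverter_to_SIS'` of `LatticeOWF.lean`, with witnesses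
`q = SIS.modulus`, `m = SIS.width`, `β = SIS.normBound`, `g = SIS.sisFunction`,
`nOf = SIS.dimOf`; the parameter conditions (polynomial bounds, `β ≥ 1`, the Micciancio–Regev
modulus condition, `dimOf → ∞`) are the lemmas proved in `SISFunction.lean`. [Ajtai 1996,
Thm. 1; Micciancio–Regev 2007, §5.1 and Thm. 5.23] [cite: MicciancioRegev2007, §5.1 (with Thm. 5.23; Ajtai 1996 Thm 1)] -/
theorem Ajtai1996_sisFunction_inverter_to_SIS'_of_core (h1 : sisFunction_polyTimeComputable)
    (h2 : sisParams_isPolyTimeParams) (h3 : Ajtai1996_sisFunction_core) :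
    Ajtai1996_sisFunction_inverter_to_SIS' :=
  ⟨modulus, width, modulus_neZero, normBound, sisFunction, dimOf, isPolyBounded_modulus,
    isPolyBounded_width, isPolyBoundedReal_normBound, h2, one_le_normBound,
    mrModulusCondition_params, h1, tendsto_dimOf, h3⟩

/-- Hence (proved) the target fact from Micciancio–Regev's Theorem 5.23 and the three facts
about the concrete SIS function. [Micciancio–Regev 2007, Thm. 5.23 and §5.1; Ajtai 1996 Thm. 1] [cite: MicciancioRegev2007, Thm. 5.23 (with §5.1; Ajtai 1996 Thm 1)] -/
theorem owfExist_of_gapSVP_worstCaseHard_of_core (h0 : MicciancioRegev2007_gapSVP_to_SIS')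
    (h1 : sisFunction_polyTimeComputable) (h2 : sisParams_isPolyTimeParams)
    (h3 : Ajtai1996_sisFunction_core) : owfExist_of_gapSVP_worstCaseHard :=
  owfExist_of_gapSVP_worstCaseHard_of_MR07 h0
    (Ajtai1996_sisFunction_inverter_to_SIS'_of_core h1 h2 h3)

/-- **The target fact from Theorem 5.23 and three polynomial-time facts** (proved): with the
probabilistic core proved in `SISFunctionSolver.lean` (`Ajtai1996_sisFunction_core_of_solver`),
`owfExist_of_gapSVP_worstCaseHard` follows from Micciancio–Regev's Theorem 5.23
(`MicciancioRegev2007_gapSVP_to_SIS'`) and the TM2-level running-time facts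
`sisFunction_polyTimeComputable`, `sisParams_isPolyTimeParams`, `sisSolver_polyTime` about
explicit functions. [Micciancio–Regev 2007, Thm. 5.23 and §5.1; Ajtai 1996 Thm. 1; Goldreich
2001, §2.4.2] [cite: MicciancioRegev2007, Thm. 5.23 (with §5.1; Ajtai 1996 Thm 1)] -/
theorem owfExist_of_gapSVP_worstCaseHard_of_solver (h0 : MicciancioRegev2007_gapSVP_to_SIS')
    (h1 : sisFunction_polyTimeComputable) (h2 : sisParams_isPolyTimeParams)
    (h3 : sisSolver_polyTime) : owfExist_of_gapSVP_worstCaseHard :=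
  owfExist_of_gapSVP_worstCaseHard_of_core h0 h1 h2 (Ajtai1996_sisFunction_core_of_solver h1 h3)

/-- **The target fact from its five leaves** (proved): Micciancio–Regev's Theorem 5.23 proper
(`GapCVP′_γ → SIS′`, `MicciancioRegev2007_gapCVP'_to_SIS'`), the closure of textbook promise-BPP
under Cook reductions of promise problems (Goldreich 2006, `mem_PromiseBPP'_of_cookReducible`),
the running time of the GMSS oracle algorithm (`gmssAlg_isPolyTime`; Lemma 5.22 itself is proved,
`gapSVP_cookReducible_gapCVP'`), and the two running-time facts about Ajtai's function and the
explicit SIS′ solver (`sisFunction_polyTimeComputable`, `sisSolver_polyTime`); the parameter fact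
`sisParams_isPolyTimeParams` is now the theorem `sisParams_isPolyTimeParams_holds`
(`SISFunctionProofs.lean`). [Micciancio–Regev 2007, Lemma 5.22 and Thm. 5.23, §5.1; Ajtai 1996
Thm. 1; Goldreich 2006 §1.2; Goldreich 2001 §2.4.2] [cite: MicciancioRegev2007, Thm. 5.23 with Lemma 5.22 and §5.1 (authors' full version p. 18, 27–30)] -/
theorem owfExist_of_gapSVP_worstCaseHard_of_leaves (hA : MicciancioRegev2007_gapCVP'_to_SIS')
    (hB : PromiseProblem.mem_PromiseBPP'_of_cookReducible) (hC : gmssAlg_isPolyTime)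
    (h1 : sisFunction_polyTimeComputable) (h3 : sisSolver_polyTime) :
    owfExist_of_gapSVP_worstCaseHard :=
  owfExist_of_gapSVP_worstCaseHard_of_solver (MicciancioRegev2007_gapSVP_to_SIS'_of_cook hA hB hC)
    h1 sisParams_isPolyTimeParams_holds h3

/-- **The target fact from its four remaining leaves** (proved): with `SISFunctionMachine.lean`,
which PROVES `sisFunction_polyTimeComputable` (Ajtai's function is polynomial-time on `TM2`),
the target follows from Micciancio–Regev's Theorem 5.23 proper
(`MicciancioRegev2007_gapCVP'_to_SIS'`), the closure of promise-BPP under Cook reductions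
(`mem_PromiseBPP'_of_cookReducible`), and the TM2 running-time facts of the GMSS oracle algorithm
(`gmssAlg_isPolyTime`) and of the explicit SIS′ solver (`sisSolver_polyTime`).
[Micciancio–Regev 2007, Lemma 5.22 and Thm. 5.23, §5.1; Ajtai 1996 Thm. 1; Goldreich 2006 §1.2;
Goldreich 2001 §2.4.2] [cite: MicciancioRegev2007, Thm. 5.23 with Lemma 5.22 and §5.1 (authors' full version p. 18, 27–30)] -/
theorem owfExist_of_gapSVP_worstCaseHard_of_four (hA : MicciancioRegev2007_gapCVP'_to_SIS')
    (hB : PromiseProblem.mem_PromiseBPP'_of_cookReducible) (hC : gmssAlg_isPolyTime)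
    (h3 : sisSolver_polyTime) : owfExist_of_gapSVP_worstCaseHard :=
  owfExist_of_gapSVP_worstCaseHard_of_leaves hA hB hC sisFunction_polyTimeComputable_holds h3

/-- **The target fact from its three remaining leaves** (proved): with
`GapCVPPrimeMachine.lean`, which PROVES `gmssAlg_isPolyTime` (the step function of the GMSS
oracle algorithm is polynomial-time on `TM2`, so Micciancio–Regev's Lemma 5.22 is a Cook
reduction of promise problems with no remaining hypothesis), the target follows from
Micciancio–Regev's Theorem 5.23 proper (`MicciancioRegev2007_gapCVP'_to_SIS'`), the closure of
promise-BPP under Cook reductions (Goldreich 2006, `mem_PromiseBPP'_of_cookReducible`), and the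
TM2 running time of the explicit SIS′ solver (`sisSolver_polyTime`).
[Micciancio–Regev 2007, Lemma 5.22 and Thm. 5.23, §5.1; Ajtai 1996 Thm. 1; Goldreich 2006 §1.2;
Goldreich 2001 §2.4.2] [cite: MicciancioRegev2007, Thm. 5.23 with Lemma 5.22 and §5.1 (authors' full version p. 18, 27–30)] -/
theorem owfExist_of_gapSVP_worstCaseHard_of_three (hA : MicciancioRegev2007_gapCVP'_to_SIS')
    (hB : PromiseProblem.mem_PromiseBPP'_of_cookReducible) (h3 : sisSolver_polyTime) :
    owfExist_of_gapSVP_worstCaseHard :=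
  owfExist_of_gapSVP_worstCaseHard_of_four hA hB gmssAlg_isPolyTime_holds h3

/-- **The target fact from its two remaining leaves** (proved): with
`PromiseCookReductionsProofs.lean`, which PROVES the closure of textbook promise-BPP under Cook
reductions of promise problems (`PromiseProblem.mem_PromiseBPP'_of_cookReducible_holds`; Goldreich
2006, §1.2, remark after Def. 3), the target follows from Micciancio–Regev's Theorem 5.23 proper
(`MicciancioRegev2007_gapCVP'_to_SIS'`, GapCVP′ → SIS′: Gaussian measures, the sampling and
combining procedures, the Aharonov–Regev verifier) and the TM2 running time of the explicit SIS′
solver (`sisSolver_polyTime`). Everything else in the printed proof — Lemma 5.22 as a Cook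
reduction and its running time, the Cook closure of promise-BPP, Ajtai's function and its running
time, the collision/inversion analysis of the SIS-function step, and all glue — is proved in the
tree. [Micciancio–Regev 2007, Lemma 5.22 and Thm. 5.23, §5.1; Ajtai 1996 Thm. 1; Goldreich 2006
§1.2; Goldreich 2001 §2.4.2] [cite: MicciancioRegev2007, Thm. 5.23 with Lemma 5.22 and §5.1 (authors' full version p. 18, 27–30)] -/
theorem owfExist_of_gapSVP_worstCaseHard_of_two (hA : MicciancioRegev2007_gapCVP'_to_SIS')
    (h3 : sisSolver_polyTime) : owfExist_of_gapSVP_worstCaseHard :=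
  owfExist_of_gapSVP_worstCaseHard_of_three hA
    Complexity.PromiseProblem.mem_PromiseBPP'_of_cookReducible_holds h3


/-- **The target fact from its one remaining leaf** (proved): with `SISSolverMachine.lean`, which
PROVES the TM2 running time of the explicit SIS′ solver (`sisSolver_polyTime_holds`), the target
`owfExist_of_gapSVP_worstCaseHard` follows from Micciancio–Regev's Theorem 5.23 proper alone
(`MicciancioRegev2007_gapCVP'_to_SIS'`: for `q ≥ 4 √m n^{1.5} β`, `γ = 14π √n β`, a PPT reduction
from GapCVP′_γ in the worst case to SIS′_{q,m,β} on the average; MR07 §3–5: Gaussian measures,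
the smoothing parameter, the sampling and combining procedures, the Aharonov–Regev verifier).
Everything else in the printed proof of "worst-case GapSVP hardness ⇒ one-way functions" is
proved in the tree. [Micciancio–Regev 2007, Lemma 5.22 and Thm. 5.23, §5.1; Ajtai 1996 Thm. 1;
Goldreich 2006 §1.2; Goldreich 2001 §2.4.2] [cite: MicciancioRegev2007, Thm. 5.23 with Lemma 5.22 and §5.1 (authors' full version p. 18, 27–30)] -/
theorem owfExist_of_gapSVP_worstCaseHard_of_one (hA : MicciancioRegev2007_gapCVP'_to_SIS') :
    owfExist_of_gapSVP_worstCaseHard :=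
  owfExist_of_gapSVP_worstCaseHard_of_two hA sisSolver_polyTime_holds

/-! ### Discharges of the SIS-function step (F2) and of its probabilistic core

With all three leaves of the concrete construction proved in the tree — the `TM2` running time
of Ajtai's function (`sisFunction_polyTimeComputable_holds`, `SISFunctionMachine.lean`), of its
parameters (`sisParams_isPolyTimeParams_holds`, `SISFunctionProofs.lean`) and of the explicit
SIS′ solver (`sisSolver_polyTime_holds`, `SISSolverMachine.lean`), whose success guarantee is the
theorem `SIS.sisSolver_reduction` (`SISFunctionSolver.lean`) — the named facts
`Ajtai1996_sisFunction_core` (`SISFunction.lean`) and `Ajtai1996_sisFunction_inverter_to_SIS'`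
(`LatticeOWF.lean`) are now theorems. Source check (authors' full version of Micciancio–Regev
2007, §5.1, p. 18): "if (x, y) is a collision for f_A, then z = x − y ∈ Λ_q(A) ∖ {0} is a nonzero
lattice vector of length at most β(n) = (d(n) − 1)√m(n). So, finding collisions on the average
when A is chosen uniformly at random is at least as hard as solving random instances of
SIS_{q,m,β}"; here `d = 2`, and the passage from an inverter of the packaged function to a
collision finder (second-preimage loss `qⁿ/2^m`) is Ajtai 1996, Thm. 1 / Goldreich 2001 §2.4.2,
proved in `SISFunctionSolver.lean`.
-/

/-- **Discharge of the probabilistic core `Ajtai1996_sisFunction_core`** (`SISFunction.lean`):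
for every PPT inverter `A` of Ajtai's packaged function `SIS.sisFunction` and exponent `c` there
is a PPT average-case SIS′ solver (the explicit `SIS.sisSolver A (p.eval ·)`, `p` the coin
polynomial of `A`) succeeding with probability `≥ 1/(dimOf k)^{c'}` in dimension `dimOf k`
whenever `A` inverts with probability `≥ 1/kᶜ` at length `k ≥ k₀`. Proof: the reduction theorem
`Ajtai1996_sisFunction_core_of_solver` fed with the two proved running-time leaves
`sisFunction_polyTimeComputable_holds` and `sisSolver_polyTime_holds`.
[Micciancio–Regev 2007, §5.1 (authors' full version p. 18: family `H_{q,m,d}`, collision remark);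
Ajtai 1996, Thm. 1; Goldreich 2001, §2.4.2] [cite: MicciancioRegev2007, §5.1 (p. 18, collision remark); with Ajtai 1996 Thm 1] -/
theorem Ajtai1996_sisFunction_core_holds : Ajtai1996_sisFunction_core :=
  Ajtai1996_sisFunction_core_of_solver sisFunction_polyTimeComputable_holds sisSolver_polyTime_holds

/-- **Discharge of the named fact `Ajtai1996_sisFunction_inverter_to_SIS'`** (`LatticeOWF.lean`,
the SIS-function step F2 of the decomposition of `owfExist_of_gapSVP_worstCaseHard`): there are
parameter functions in the regime of Micciancio–Regev's Theorem 5.23, a polynomial-time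
computable `g : {0,1}* → {0,1}*` and a dimension map `nOf → ∞` such that PPT inverters of `g`
with inverse-polynomial success yield PPT average-case SIS′ solvers with inverse-polynomial
success in the corresponding dimensions. Witnesses: `q = SIS.modulus = 2^{16 ⌊log₂(2n+4)⌋}`,
`m = SIS.width = 2 n log₂ q`, `β = SIS.normBound = m + 1`, `g = SIS.sisFunction`,
`nOf = SIS.dimOf` (`Ajtai1996_sisFunction_inverter_to_SIS'_of_core`), with the three leaves
`sisFunction_polyTimeComputable_holds`, `sisParams_isPolyTimeParams_holds` and
`Ajtai1996_sisFunction_core_holds`. [Micciancio–Regev 2007, §5.1 (authors' full version p. 18: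
family `H_{q,m,d}` with `d = 2`, "if (x, y) is a collision for f_A then z = x − y ∈ Λ_q(A) ∖ {0}
is a nonzero lattice vector of length at most β(n) = (d(n) − 1)√m(n)"); Ajtai 1996, Thm. 1;
Goldreich 2001, Def. 2.2.1 and §2.4.2] [cite: MicciancioRegev2007, §5.1 (p. 18, family H_{q,m,d} and collision remark); with Ajtai 1996 Thm 1, Goldreich 2001 §2.4.2] -/
theorem Ajtai1996_sisFunction_inverter_to_SIS'_holds : Ajtai1996_sisFunction_inverter_to_SIS' :=
  Ajtai1996_sisFunction_inverter_to_SIS'_of_core sisFunction_polyTimeComputable_holds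
    sisParams_isPolyTimeParams_holds Ajtai1996_sisFunction_core_holds

end Literature.Computability.Cryptography


end
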